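import Mathlib
import Summits.NavierStokesRegularity.NavierStokesRegularity.Theorems.TaoLadderRungTwoBreakOneShiftWindowEnergy
import HarnessLib

/-!
# The one-shift window system, IV: the WINDOW-RUN MAP and a CONSTRUCTOR of the window certificate
# `OneShiftWindowCert` from a preconditioner (cell harvest/h2-tao-ladder, seat p2; rung1/RUNG1-P2G9-REPORT.md
# §37/§40; support for K1(1) = `NoSurvivingDSSOne`, stmt-NavierStokesRegularity-20205)

MODEL lattice ODEs only (Tao 2016 §4 normal form on Tao's shift set `S`); nothing here is a statement about
the Navier–Stokes equations; no item is closed.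

The window certificate `OneShiftWindowCert F ε₀ α` (module …OneShiftMapDefs) has two halves: the window-run map
`Φ` (existence of the window run on the whole flight from every admissible datum) and the Krawczyk map `Nmap`
of the window block with its fixed-point characterisation. Parts I–III made the first half a theorem
(`OneShiftFrame.exists_windowSolution`). This module assembles:

* `windowRunMap` — THE window-run map (the solution chosen by `exists_windowSolution`, re-assembled with the
  tails; a harmless junk value off the admissible set), with `windowRunMap_tail`, `windowRunMap_init`,
  `windowRun_windowRunMap`;
* `residual` — the one-shift residual `G_T(y, τ) = ((g(z) z_{k+1}(τ) − y_k)_{k+1<W}, (g(z) T_W(τ) − y_{W-1}),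
  e(z_D) − strig)` of a window datum (`z` = the window run at time `τ`), and `krawczyk C` — the map
  `(y, τ) ↦ (y, τ) − C(G_T(y, τ))` for ANY map `C` of the window block with `C r = 0 → r = 0`;
* `windowCertOfMatrix` — **a term of `OneShiftWindowCert F ε₀ α`** for every frame with `W > 0`, `ε₀ ≥ 0`,
  cancelling table and edge bounds `|tubeC| + tubeR ≤ Eb / Et`, and every such `C` (`Nmap_fixed`: a fixed
  point has `C(G) = 0`, hence `G = 0`, i.e. the one-shift relations and the section condition).

So the STRUCTURAL part of the certificate side of the instances T4W76 / T4E3W216 / T4E5W136 / B8E8W91 / T4E15W56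
is constructible in the kernel; what remains of RUNG1-P2G9-REPORT §37 are the eight QUANTITATIVE clauses
(hulls, Krawczyk inclusion, edge-form Lipschitz constants), now statements about kernel-defined objects once a
preconditioner `C` is fixed (the engine's is `mid(DG)⁻¹`; a kernel replay brings its own).
-/

noncomputable section

-- the sub-problem namespace repeats the summit name by design (D-0017)
set_option linter.dupNamespace false

namespace Summit.NavierStokesRegularity.NavierStokesRegularity.Theorems

namespace DSSOneShift

open Set Metric Filter Topology Literature.Analysis.FluidPDE Literature.Analysis.FluidPDE.TaoCascade
  CertificateGlueOn
open scoped NNReal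

variable {m : ℕ}

namespace OneShiftFrame

variable (F : OneShiftFrame m)

/-! ### The window-run map -/

open Classical in
/-- **THE WINDOW-RUN MAP** of the frame at `(ε₀, α)`: on data from which the window system has a solution on
the flight starting at `encode y` (all admissible data, by `exists_windowSolution`), the chosen solution
re-assembled with the tails; elsewhere the (irrelevant) frozen datum.
[cite: Tao2016AveragedNS, §4 Lemma 4.1 (4.8); cell vocabulary, harvest/h2-tao-ladder rung1/KERNEL-STAGE3-PLAN.md §2 (Φ)] -/
def windowRunMap (ε₀ : ℝ) (α : Fin m → Fin m → Fin m → ℤ × ℤ × ℤ → ℝ) (y : Fin m → ℤ → ℝ)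
    (T : Fin m → ℤ → ℝ → ℝ) : Fin m → ℤ → ℝ → ℝ :=
  if h : ∃ β : ℝ → F.WState, β 0 = F.encode y ∧
      ∀ t ∈ Icc 0 F.τhi, HasDerivWithinAt β (F.wfield ε₀ α T t (β t)) (Icc 0 F.τhi) t
  then F.familyOf (Classical.choose h) T
  else fun i k s => if F.InWindow k then y i k else T i k s

/-- Off the window the window-run map returns the tails. [folklore] -/
theorem windowRunMap_tail (ε₀ : ℝ) (α : Fin m → Fin m → Fin m → ℤ × ℤ × ℤ → ℝ) (y : Fin m → ℤ → ℝ)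
    (T : Fin m → ℤ → ℝ → ℝ) (i : Fin m) {k : ℤ} (hk : ¬ F.InWindow k) :
    F.windowRunMap ε₀ α y T i k = T i k := by
  unfold windowRunMap
  split_ifs with h
  · exact F.familyOf_of_not i hk
  · funext s; simp [hk]

/-- On admissible data the window-run map starts at `y` on the window and is a window run on the flight.
[cite: Tao2016AveragedNS, §4 Lemma 4.1 (4.8); Teschl2012, Cor. 2.16] -/
theorem windowRunMap_spec {ε₀ : ℝ} (hε : 0 ≤ ε₀) (hW : 0 < F.W)
    {α : Fin m → Fin m → Fin m → ℤ × ℤ × ℤ → ℝ} (hα : IsCancellingCoeff α)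
    (hEb : ∀ i, |F.tubeC i (-1)| + F.tubeR (-1) ≤ F.Eb) (hEt : ∀ i, |F.tubeC i F.W| + F.tubeR F.W ≤ F.Et)
    {y : Fin m → ℤ → ℝ} {T : Fin m → ℤ → ℝ → ℝ} (hyT : F.AdmData y T) :
    (∀ i k, F.InWindow k → F.windowRunMap ε₀ α y T i k 0 = y i k) ∧
      WindowRun shiftSet ε₀ α 0 ((F.W : ℤ) - 1) F.Eb F.Et F.τhi (F.windowRunMap ε₀ α y T) := by
  have h := F.exists_windowSolution hε hW hα hEb hEt hyT
  unfold windowRunMap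
  rw [dif_pos h]
  exact ⟨fun i k hk => F.familyOf_init (Classical.choose_spec h).1 i hk,
    F.windowRun_familyOf α hyT hEb hEt (Classical.choose_spec h).2⟩

/-! ### The Krawczyk map of the window block for a given preconditioner -/

/-- **The one-shift residual** of a window datum `(y, τ)` given the tails `T`: on the window block
`G_{i,j} = g(z) z_{i,j+1}(τ) − y_{i,j}` for `j+1 < W` and `g(z) T_{i,W}(τ) − y_{i,W-1}` for `j = W-1`, and the
section component `e(z_D) − strig`, where `z` is the window run at time `τ`.
[cite: Tao2016AveragedNS, §5.3 (rescaling between epochs); cell vocabulary, harvest/h2-tao-ladder rung1/STAGE2-LEMMA.md §2 (G), rung1/KERNEL-STAGE3-PLAN.md §5] -/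
def residual (ε₀ : ℝ) (α : Fin m → Fin m → Fin m → ℤ × ℤ × ℤ → ℝ) (T : Fin m → ℤ → ℝ → ℝ)
    (p : (Fin m → ℤ → ℝ) × ℝ) : F.WState × ℝ :=
  (fun i j =>
      if ((j : ℕ) : ℤ) + 1 < F.W then
        gfac (slice (F.windowRunMap ε₀ α p.1 T) p.2) * F.windowRunMap ε₀ α p.1 T i (((j : ℕ) : ℤ) + 1) p.2 -
          p.1 i ((j : ℕ) : ℤ)
      else gfac (slice (F.windowRunMap ε₀ α p.1 T) p.2) * T i F.W p.2 - p.1 i ((j : ℕ) : ℤ),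
    shellEnergy (slice (F.windowRunMap ε₀ α p.1 T) p.2) F.D - F.strig)

/-- **The Krawczyk-type map** of the window block with preconditioner `C`:
`(y, τ) ↦ (y, τ) − C(G_T(y, τ))` (window components; zero off the window).
[cite: Tao2016AveragedNS, §5.3; cell vocabulary, harvest/h2-tao-ladder rung1/STAGE2-LEMMA.md §2 (N = x − C·G)] -/
def krawczyk (ε₀ : ℝ) (α : Fin m → Fin m → Fin m → ℤ × ℤ × ℤ → ℝ) (C : F.WState × ℝ → F.WState × ℝ)
    (T : Fin m → ℤ → ℝ → ℝ) (p : (Fin m → ℤ → ℝ) × ℝ) : (Fin m → ℤ → ℝ) × ℝ :=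
  (fun i k => if h : F.InWindow k then p.1 i k - (C (F.residual ε₀ α T p)).1 i (F.widx h) else 0,
    p.2 - (C (F.residual ε₀ α T p)).2)

/-- A fixed point of the Krawczyk-type map kills `C(G)`. [folklore (x = x − C G ⇒ C G = 0)] -/
theorem apply_residual_eq_zero_of_fixed (ε₀ : ℝ) (α : Fin m → Fin m → Fin m → ℤ × ℤ × ℤ → ℝ)
    (C : F.WState × ℝ → F.WState × ℝ) (T : Fin m → ℤ → ℝ → ℝ) (y : Fin m → ℤ → ℝ) (τ : ℝ)
    (hfix : F.krawczyk ε₀ α C T (y, τ) = (y, τ)) : C (F.residual ε₀ α T (y, τ)) = 0 := by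
  have h1 := congrArg Prod.fst hfix
  have h2 := congrArg Prod.snd hfix
  simp only [krawczyk] at h1 h2
  refine Prod.ext ?_ ?_
  · funext i j
    have h3 := congrFun (congrFun h1 i) ((j : ℕ) : ℤ)
    rw [dif_pos (F.inWindow_natCast j), F.widx_natCast] at h3
    simp only [Prod.fst_zero, Pi.zero_apply]
    linarith
  · simp only [Prod.snd_zero]
    linarith

/-! ### The constructor -/

/-- **A WINDOW CERTIFICATE FROM A PRECONDITIONER.** For a frame with `W > 0`, `ε₀ ≥ 0`, a cancelling table,
edge bounds `|tubeC| + tubeR ≤ Eb / Et` at the shells `-1` and `W`, and any map `C` of the window block with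
`C r = 0 → r = 0`: the window-run map (parts I–III) and the Krawczyk-type map `(y,τ) ↦ (y,τ) − C(G_T(y,τ))` form an
`OneShiftWindowCert F ε₀ α`. The quantitative clauses of the later proof files (hulls, Krawczyk inclusion,
edge-form Lipschitz constants) are then statements about these kernel-defined objects.
[cite: Tao2016AveragedNS, §4 Lemma 4.1 (4.8) and §5.3; cell vocabulary, harvest/h2-tao-ladder rung1/STAGE2-LEMMA.md §2–§3, rung1/KERNEL-STAGE3-PLAN.md §2/§5, rung1/RUNG1-P2G9-REPORT.md §40] -/
def windowCertOfMatrix {ε₀ : ℝ} (hε : 0 ≤ ε₀) (hW : 0 < F.W)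
    {α : Fin m → Fin m → Fin m → ℤ × ℤ × ℤ → ℝ} (hα : IsCancellingCoeff α)
    (hEb : ∀ i, |F.tubeC i (-1)| + F.tubeR (-1) ≤ F.Eb) (hEt : ∀ i, |F.tubeC i F.W| + F.tubeR F.W ≤ F.Et)
    (C : F.WState × ℝ → F.WState × ℝ) (hC : ∀ r, C r = 0 → r = 0) : OneShiftWindowCert F ε₀ α where
  Φ := F.windowRunMap ε₀ α
  Nmap := F.krawczyk ε₀ α C
  Φ_tail y T i k hk := F.windowRunMap_tail ε₀ α y T i hk
  Φ_init y T hyT i k hk := (F.windowRunMap_spec hε hW hα hEb hEt hyT).1 i k hk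
  Φ_run y T hyT := (F.windowRunMap_spec hε hW hα hEb hEt hyT).2
  Nmap_support T y τ i k hk := by simp [krawczyk, hk]
  Nmap_fixed y T τ _ _ _ hfix := by
    have hG : F.residual ε₀ α T (y, τ) = 0 := hC _ (F.apply_residual_eq_zero_of_fixed ε₀ α C T y τ hfix)
    have hG1 : ∀ i (j : Fin F.W), (F.residual ε₀ α T (y, τ)).1 i j = 0 := fun i j => by
      rw [hG]; rfl
    have hG2 : (F.residual ε₀ α T (y, τ)).2 = 0 := by rw [hG]; rfl
    refine ⟨fun i k hk0 hk1 => ?_, fun i => ?_, ?_⟩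
    · have hk : F.InWindow k := ⟨hk0, by omega⟩
      have h := hG1 i (F.widx hk)
      simp only [residual, F.natCast_widx hk, if_pos hk1] at h
      linarith
    · have hk : F.InWindow ((F.W : ℤ) - 1) := ⟨by omega, by omega⟩
      have h := hG1 i (F.widx hk)
      have hnot : ¬ ((F.W : ℤ) - 1 + 1 < F.W) := by omega
      simp only [residual, F.natCast_widx hk, if_neg hnot] at h
      linarith
    · have h := hG2
      simp only [residual] at h
      linarith

/-- The window-run map of the constructed certificate is `windowRunMap`. [folklore] -/
theorem windowCertOfMatrix_Φ {ε₀ : ℝ} (hε : 0 ≤ ε₀) (hW : 0 < F.W)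
    {α : Fin m → Fin m → Fin m → ℤ × ℤ × ℤ → ℝ} (hα : IsCancellingCoeff α)
    (hEb : ∀ i, |F.tubeC i (-1)| + F.tubeR (-1) ≤ F.Eb) (hEt : ∀ i, |F.tubeC i F.W| + F.tubeR F.W ≤ F.Et)
    (C : F.WState × ℝ → F.WState × ℝ) (hC : ∀ r, C r = 0 → r = 0) :
    (F.windowCertOfMatrix hε hW hα hEb hEt C hC).Φ = F.windowRunMap ε₀ α := rfl

/-- The Krawczyk map of the constructed certificate is `krawczyk C`. [folklore] -/
theorem windowCertOfMatrix_Nmap {ε₀ : ℝ} (hε : 0 ≤ ε₀) (hW : 0 < F.W)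
    {α : Fin m → Fin m → Fin m → ℤ × ℤ × ℤ → ℝ} (hα : IsCancellingCoeff α)
    (hEb : ∀ i, |F.tubeC i (-1)| + F.tubeR (-1) ≤ F.Eb) (hEt : ∀ i, |F.tubeC i F.W| + F.tubeR F.W ≤ F.Et)
    (C : F.WState × ℝ → F.WState × ℝ) (hC : ∀ r, C r = 0 → r = 0) :
    (F.windowCertOfMatrix hε hW hα hEb hEt C hC).Nmap = F.krawczyk ε₀ α C := rfl

/-- **The window certificate type is inhabited** under the structural hypotheses (take `C = id`).
[cite: Tao2016AveragedNS, §4 Lemma 4.1 (4.8) and §5.3; cell vocabulary, harvest/h2-tao-ladder rung1/KERNEL-STAGE3-PLAN.md §2] -/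
theorem nonempty_windowCert {ε₀ : ℝ} (hε : 0 ≤ ε₀) (hW : 0 < F.W)
    {α : Fin m → Fin m → Fin m → ℤ × ℤ × ℤ → ℝ} (hα : IsCancellingCoeff α)
    (hEb : ∀ i, |F.tubeC i (-1)| + F.tubeR (-1) ≤ F.Eb) (hEt : ∀ i, |F.tubeC i F.W| + F.tubeR F.W ≤ F.Et) :
    Nonempty (OneShiftWindowCert F ε₀ α) :=
  ⟨F.windowCertOfMatrix hε hW hα hEb hEt id fun _ h => h⟩

end OneShiftFrame

end DSSOneShift

end Summit.NavierStokesRegularity.NavierStokesRegularity.Theorems
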